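import Literature.MathematicalPhysics.QuantumLattice.GrassmannGaussianQuadraticInsertion
import Mathlib.LinearAlgebra.Matrix.Charpoly.Coeff
import Mathlib.Analysis.Calculus.MeanValue
import Mathlib.Analysis.Calculus.Deriv.Polynomial
import Mathlib.Analysis.Calculus.Deriv.Inv
import Mathlib.Analysis.Complex.Basic
import HarnessLib

/-!
# The Gaussian integral of the exponential of a quadratic form: `(∫ dμ_C e^{q})² = det(1 − A S)`

Topic `Literature/MathematicalPhysics/QuantumLattice`; companion of `GrassmannGaussianQuadraticInsertion.lean` (Laplacian-form
Gaussian expectation `gaussExpect` of Salmhofer 1999, §4.3, arbitrary covariance `C`).  There a quadratic insertion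
`q = Σ_{X,Y} N(X,Y) ψ(X)ψ(Y)` was shown to renormalise the covariance, `∫ dμ_C e^{q} F = (∫ dμ_C e^{q}) · ∫ dμ_{C'} F`; here the
NORMALISATION is computed, over `ℂ`:

  `(∫ dμ_C e^{q})² = det(1 − A S)`,  `A(X,Y) = ½(C(Y,X) − C(X,Y))` the pair function, `S = N − Nᵀ`

(`sq_gaussExpect_grassmannExp_eq_det`; for antisymmetric `C`: `= det(1 + C S)`, `sq_gaussExpect_grassmannExp_eq_det_of_transpose_eq_neg`)
— the fermionic Gaussian integral of a Gaussian is a PFAFFIAN, whose square is the determinant (Feldman–Knörrer–Trubowitz 2002,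
§I.3–I.4; Salmhofer 1999, App. B.3), proved WITHOUT Pfaffians and without invertibility of `C` or of `1 − A S`:
the cocycles `Z(t+s) = Z(t) Z̃_t(s)` (measure change) and `det(1 − (t+s)AS) = det(1 − tAS) det(1 − s A'_t S)` (`A'_t` the renormalised pair
function) reduce the logarithmic derivatives of both sides at `t` to derivatives at `0`, where `∂_s ∫ dμ e^{sq} = ∫ dμ q = Σ N A'` and
`∂_s det(1 − s A'S) = −tr(A'S) = 2 Σ N A'` (Jacobi); hence `Z² / det` is constant near `t = 0`, and both sides are polynomials in `t`.

## Sources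

J. Feldman, H. Knörrer, E. Trubowitz, *Fermionic Functional Integrals and the Renormalization Group* (AMS 2002), §I.3–I.4
[`FeldmanKnorrerTrubowitz2002`]; M. Salmhofer, *Renormalization: An Introduction* (Springer 1999), §4.3, App. B.3 [`Salmhofer1999`].
[folklore]
-/

noncomputable section

namespace Literature.MathematicalPhysics.QuantumLattice

open GrassmannAlgebra Polynomial Matrix

variable {Γ : Type*} [Fintype Γ] [DecidableEq Γ]

/-! ### Algebraic preliminaries (any commutative `ℚ`-algebra) -/

section Algebra

variable {R : Type*} [CommRing R] [Algebra ℚ R]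

omit [Fintype Γ] [DecidableEq Γ] in
/-- The pair function of the covariance `−P`, `P` antisymmetric, is `P` itself. [folklore] -/
theorem pairing_neg_of_transpose_eq_neg {P : Matrix Γ Γ R} (hP : P.transpose = -P) (X Y : Γ) :
    ((1 / 2 : ℚ) • (1 : R)) * ((-P) Y X - (-P) X Y) = P X Y := by
  have hYX : P Y X = -P X Y := by rw [← Matrix.transpose_apply P X Y, hP, Matrix.neg_apply]
  rw [Matrix.neg_apply, Matrix.neg_apply, hYX, neg_neg, sub_neg_eq_add, half_smul_one_mul_add_self]

/-- **The Gaussian expectation of the quadratic element**: `∫ dμ_C Σ N(X,Y)ψ(X)ψ(Y) = Σ_{X,Y} N(X,Y) A(X,Y)` with the pair function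
`A(X,Y) = ½(C(Y,X) − C(X,Y))`. [folklore] -/
theorem gaussExpect_of_eq_quadratic (C N : Matrix Γ Γ R) {q : GrassmannAlgebra R Γ}
    (hq : q = ∑ X, ∑ Y, N X Y • (gen R X * gen R Y)) :
    gaussExpect R C q = ∑ X, ∑ Y, N X Y * (((1 / 2 : ℚ) • (1 : R)) * (C Y X - C X Y)) := by
  subst hq
  simp only [map_sum, map_smul, smul_eq_mul, gaussExpect_gen_mul_gen]

omit [DecidableEq Γ] [Algebra ℚ R] in
/-- **Jacobi's rate equals twice the Gaussian rate**: for `P` antisymmetric and `S = N − Nᵀ`,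
`−tr(P S) = 2 Σ_{X,Y} N(X,Y) P(X,Y)`. [folklore] -/
theorem neg_trace_mul_eq_two_mul_sum {P S N : Matrix Γ Γ R} (hP : P.transpose = -P)
    (hS : S = Matrix.of fun X Y => N X Y - N Y X) :
    -(P * S).trace = 2 * ∑ X, ∑ Y, N X Y * P X Y := by
  have hYX : ∀ X Y, P Y X = -P X Y := fun X Y => by rw [← Matrix.transpose_apply P X Y, hP, Matrix.neg_apply]
  simp only [Matrix.trace, Matrix.diag, Matrix.mul_apply, hS, Matrix.of_apply, mul_sub, Finset.sum_sub_distrib]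
  have h1 : ∑ X, ∑ Y, P X Y * N Y X = -∑ X, ∑ Y, N X Y * P X Y := by
    rw [Finset.sum_comm, ← Finset.sum_neg_distrib]
    refine Finset.sum_congr rfl fun X _ => ?_
    rw [← Finset.sum_neg_distrib]
    refine Finset.sum_congr rfl fun Y _ => ?_
    rw [hYX, neg_mul, mul_comm]
  have h2 : ∑ X, ∑ Y, P X Y * N X Y = ∑ X, ∑ Y, N X Y * P X Y :=
    Finset.sum_congr rfl fun X _ => Finset.sum_congr rfl fun Y _ => mul_comm _ _
  rw [h1, h2]
  ring

omit [Algebra ℚ R] in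
/-- **The determinant cocycle**: if `(1 − t·B) M = 1` then `det(1 − (t+s)·B) = det(1 − t·B) · det(1 − s·(M B))`
(`(1 − tB)(1 − s M B) = 1 − (t+s) B`). [folklore] -/
theorem det_one_sub_add_smul {B M : Matrix Γ Γ R} {t : R} (hM : (1 - t • B) * M = 1) (s : R) :
    (1 - (t + s) • B).det = (1 - t • B).det * (1 - s • (M * B)).det := by
  rw [← Matrix.det_mul]
  congr 1
  rw [Matrix.mul_sub, Matrix.mul_one, Matrix.mul_smul, ← Matrix.mul_assoc, hM, Matrix.one_mul, add_smul, sub_sub]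

omit [Algebra ℚ R] in
/-- The renormalised resolvent: if `M (1 − t·(A S)) = 1` then `1 − (A (t·S))` has inverse `M` in the form used by
`gaussExpect_grassmannExp_mul_canonical`. [folklore] -/
theorem resolvent_smul {A S M : Matrix Γ Γ R} {t : R} (hM : M * (1 - t • (A * S)) = 1) :
    M * (1 - A * (t • S)) = 1 := by
  rwa [Matrix.mul_smul]

omit [Algebra ℚ R] [Fintype Γ] [DecidableEq Γ] in
/-- `S` scales with the quadratic form: the antisymmetrisation of `t·N` is `t·S`. [folklore] -/
theorem antisymm_smul (N : Matrix Γ Γ R) (t : R) :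
    (Matrix.of fun X Y => (t • N) X Y - (t • N) Y X) = t • Matrix.of fun X Y => N X Y - N Y X := by
  ext X Y
  simp [mul_sub]

omit [Algebra ℚ R] in
/-- The scaled quadratic element: `t·q = Σ (t·N)(X,Y) ψ(X)ψ(Y)`. [folklore] -/
theorem smul_eq_quadratic_smul (N : Matrix Γ Γ R) {q : GrassmannAlgebra R Γ}
    (hq : q = ∑ X, ∑ Y, N X Y • (gen R X * gen R Y)) (t : R) :
    t • q = ∑ X, ∑ Y, (t • N) X Y • (gen R X * gen R Y) := by
  subst hq
  simp only [Finset.smul_sum, smul_smul, Matrix.smul_apply, smul_eq_mul]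

/-- `e^{(t+s)q} = e^{tq} e^{sq}` for the (central, nilpotent) quadratic element. [folklore] -/
theorem grassmannExp_add_smul_quadratic (N : Matrix Γ Γ R) {q : GrassmannAlgebra R Γ}
    (hq : q = ∑ X, ∑ Y, N X Y • (gen R X * gen R Y)) (t s : R) :
    grassmannExp ((t + s) • q) = grassmannExp (t • q) * grassmannExp (s • q) := by
  have ht := isNilpotent_of_eq_quadratic (t • N) (smul_eq_quadratic_smul N hq t)
  have hs := isNilpotent_of_eq_quadratic (s • N) (smul_eq_quadratic_smul N hq s)
  rw [add_smul, grassmannExp, grassmannExp, grassmannExp,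
    IsNilpotent.exp_add_of_commute (commute_of_eq_quadratic (t • N) (smul_eq_quadratic_smul N hq t) _) ht hs]

/-- **The partition-function cocycle**: if `M (1 − t·(A S)) = 1` (`A` the pair function of `C`, `S = N − Nᵀ`) then for every `s`
`∫ dμ_C e^{(t+s)q} = (∫ dμ_C e^{tq}) · ∫ dμ_{−MA} e^{sq}` (measure change at "time" `t`). [folklore] -/
theorem gaussExpect_grassmannExp_add_smul (C N : Matrix Γ Γ R) {q : GrassmannAlgebra R Γ}
    (hq : q = ∑ X, ∑ Y, N X Y • (gen R X * gen R Y)) {A S M : Matrix Γ Γ R}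
    (hA : A = Matrix.of fun X Y => ((1 / 2 : ℚ) • (1 : R)) * (C Y X - C X Y))
    (hS : S = Matrix.of fun X Y => N X Y - N Y X) {t : R} (hM : M * (1 - t • (A * S)) = 1) (s : R) :
    gaussExpect R C (grassmannExp ((t + s) • q)) =
      gaussExpect R C (grassmannExp (t • q)) * gaussExpect R (-(M * A)) (grassmannExp (s • q)) := by
  rw [grassmannExp_add_smul_quadratic N hq t s]
  refine gaussExpect_grassmannExp_mul_canonical (t • N) (smul_eq_quadratic_smul N hq t) C hA
    (S := t • S) ?_ (resolvent_smul hM) _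
  rw [hS, antisymm_smul]

end Algebra

/-! ### Over `ℂ`: both sides are polynomials in the strength `t` of the insertion -/

section Complex

variable (C N : Matrix Γ Γ ℂ) {q : GrassmannAlgebra ℂ Γ} (hq : q = ∑ X, ∑ Y, N X Y • (gen ℂ X * gen ℂ Y))
include hq

/-- **`t ↦ ∫ dμ_C e^{tq}` is a polynomial**: `= Σ_{k ≤ |Γ|+1} t^k/k! ∫ dμ_C q^k` (`q^{|Γ|+1} = 0`). [folklore] -/
theorem gaussExpect_grassmannExp_smul_eq_eval (t : ℂ) :
    gaussExpect ℂ C (grassmannExp (t • q)) =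
      (∑ k ∈ Finset.range (Fintype.card Γ + 2),
        Polynomial.C (((k.factorial : ℂ))⁻¹ * gaussExpect ℂ C (q ^ k)) * X ^ k).eval t := by
  have hq0 : constPart ℂ q = 0 := constPart_eq_zero_of_eq_quadratic N hq
  have hnil : (t • q) ^ (Fintype.card Γ + 2) = 0 := by
    rw [_root_.smul_pow, pow_succ q (Fintype.card Γ + 1), pow_card_succ_eq_zero_of_constPart_eq_zero ℂ hq0, zero_mul,
      smul_zero]
  rw [grassmannExp, IsNilpotent.exp_eq_sum hnil, map_sum, Polynomial.eval_finsetSum]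
  refine Finset.sum_congr rfl fun k _ => ?_
  simp only [LinearMap.map_smul_of_tower, _root_.smul_pow, map_smul, smul_eq_mul, Polynomial.eval_mul, Polynomial.eval_C,
    Polynomial.eval_pow, Polynomial.eval_X, Rat.smul_def]
  push_cast
  ring

/-- **`∂_s|₀ ∫ dμ_C e^{sq} = ∫ dμ_C q`.** [folklore] -/
theorem hasDerivAt_gaussExpect_grassmannExp_smul_zero :
    HasDerivAt (fun s : ℂ => gaussExpect ℂ C (grassmannExp (s • q))) (gaussExpect ℂ C q) 0 := by
  set P : ℂ[X] := ∑ k ∈ Finset.range (Fintype.card Γ + 2),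
    Polynomial.C (((k.factorial : ℂ))⁻¹ * gaussExpect ℂ C (q ^ k)) * X ^ k with hP
  have hfun : (fun s : ℂ => gaussExpect ℂ C (grassmannExp (s • q))) = fun s => P.eval s := by
    funext s
    exact gaussExpect_grassmannExp_smul_eq_eval C N hq s
  have hder : P.derivative.eval 0 = gaussExpect ℂ C q := by
    rw [← Polynomial.coeff_zero_eq_eval_zero, Polynomial.coeff_derivative, zero_add, Nat.cast_zero, zero_add, mul_one, hP,
      Polynomial.finsetSum_coeff]
    simp only [Polynomial.coeff_C_mul_X_pow]
    rw [Finset.sum_ite_eq (Finset.range (Fintype.card Γ + 2)) 1, if_pos (Finset.mem_range.2 (by omega))]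
    simp
  rw [hfun, ← hder]
  exact Polynomial.hasDerivAt P 0

omit hq in
/-- `det(1 − s·B)` as the evaluation of the polynomial `det(1 + X·(−B))`. [folklore] -/
theorem eval_det_one_add_X_smul_neg (B : Matrix Γ Γ ℂ) (s : ℂ) :
    (Matrix.det (1 + (X : ℂ[X]) • (-B).map Polynomial.C)).eval s = (1 - s • B).det := by
  rw [← Polynomial.coe_evalRingHom, RingHom.map_det, RingHom.mapMatrix_apply]
  congr 1
  ext i j
  simp only [Matrix.map_apply, Matrix.add_apply, Matrix.smul_apply, Matrix.neg_apply, Polynomial.coe_evalRingHom,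
    smul_eq_mul, Polynomial.eval_add, Polynomial.eval_mul, Polynomial.eval_X, Polynomial.eval_C, Matrix.sub_apply,
    Matrix.one_apply, sub_eq_add_neg, mul_neg]
  split_ifs <;> simp

omit hq in
/-- **Jacobi at zero**: `∂_s|₀ det(1 − s·B) = −tr B`. [folklore] -/
theorem hasDerivAt_det_one_sub_smul_zero (B : Matrix Γ Γ ℂ) :
    HasDerivAt (fun s : ℂ => (1 - s • B).det) (-B.trace) 0 := by
  have hfun : (fun s : ℂ => (1 - s • B).det) = fun s => (Matrix.det (1 + (X : ℂ[X]) • (-B).map Polynomial.C)).eval s := by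
    funext s
    exact (eval_det_one_add_X_smul_neg B s).symm
  rw [hfun, ← Matrix.trace_neg, ← Matrix.derivative_det_one_add_X_smul (-B)]
  exact Polynomial.hasDerivAt _ 0

/-! ### The flow: logarithmic derivatives at `t` from derivatives at `0` -/

variable {A S : Matrix Γ Γ ℂ} (hA : A = Matrix.of fun X Y => ((1 / 2 : ℚ) • (1 : ℂ)) * (C Y X - C X Y))
  (hS : S = Matrix.of fun X Y => N X Y - N Y X)
include hA hS

/-- **The flow of the partition function**: where `det(1 − t A S) ≠ 0`, with `M = (1 − t A S)⁻¹` and `A' = M A` the renormalised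
pair function, `∂_t ∫ dμ_C e^{tq} = (∫ dμ_C e^{tq}) · Σ_{X,Y} N(X,Y) A'(X,Y)`. [folklore] -/
theorem hasDerivAt_gaussExpect_grassmannExp_smul {t : ℂ} (ht : (1 - t • (A * S)).det ≠ 0) :
    HasDerivAt (fun s : ℂ => gaussExpect ℂ C (grassmannExp (s • q)))
      (gaussExpect ℂ C (grassmannExp (t • q)) * ∑ X, ∑ Y, N X Y * ((1 - t • (A * S))⁻¹ * A) X Y) t := by
  set M : Matrix Γ Γ ℂ := (1 - t • (A * S))⁻¹ with hMdef
  have hM : M * (1 - t • (A * S)) = 1 := Matrix.nonsing_inv_mul _ (Ne.isUnit ht)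
  -- the cocycle `Z(t') = Z(t) · Z̃(t' − t)`
  have hcoc : (fun s : ℂ => gaussExpect ℂ C (grassmannExp (s • q))) =
      fun s => gaussExpect ℂ C (grassmannExp (t • q)) * gaussExpect ℂ (-(M * A)) (grassmannExp ((s - t) • q)) := by
    funext s
    have h := gaussExpect_grassmannExp_add_smul C N hq hA hS hM (s - t)
    rwa [add_sub_cancel] at h
  -- the renormalised pair function is antisymmetric, so `−MA` realises it
  have hanti : (M * A).transpose = -(M * A) :=
    transpose_resolvent_mul_pairing ℂ (hA ▸ transpose_pairing_eq_neg ℂ C)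
      (show (t • S).transpose = -(t • S) by rw [Matrix.transpose_smul, hS, transpose_sub_transpose_eq_neg, smul_neg])
      (resolvent_smul hM)
  have hrate : gaussExpect ℂ (-(M * A)) q = ∑ X, ∑ Y, N X Y * (M * A) X Y := by
    rw [gaussExpect_of_eq_quadratic (-(M * A)) N hq]
    simp only [pairing_neg_of_transpose_eq_neg hanti]
  have h0 : HasDerivAt (fun s : ℂ => gaussExpect ℂ (-(M * A)) (grassmannExp (s • q))) (gaussExpect ℂ (-(M * A)) q) (t - t) := by
    rw [sub_self]
    exact hasDerivAt_gaussExpect_grassmannExp_smul_zero (-(M * A)) N hq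
  have h1 : HasDerivAt (fun s : ℂ => gaussExpect ℂ (-(M * A)) (grassmannExp ((s - t) • q)))
      (gaussExpect ℂ (-(M * A)) q * 1) t :=
    h0.comp t (h := fun s : ℂ => s - t) ((hasDerivAt_id t).sub_const t)
  rw [hcoc, ← hrate]
  simpa using h1.const_mul (gaussExpect ℂ C (grassmannExp (t • q)))

omit hq in
/-- **The flow of the determinant**: where `det(1 − t A S) ≠ 0`, with `M = (1 − t A S)⁻¹`,
`∂_t det(1 − t A S) = det(1 − t A S) · 2 Σ_{X,Y} N(X,Y) (M A)(X,Y)` (cocycle + Jacobi at `0`). [folklore] -/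
theorem hasDerivAt_det_one_sub_smul {t : ℂ} (ht : (1 - t • (A * S)).det ≠ 0) :
    HasDerivAt (fun s : ℂ => (1 - s • (A * S)).det)
      ((1 - t • (A * S)).det * (2 * ∑ X, ∑ Y, N X Y * ((1 - t • (A * S))⁻¹ * A) X Y)) t := by
  set M : Matrix Γ Γ ℂ := (1 - t • (A * S))⁻¹ with hMdef
  have hM : M * (1 - t • (A * S)) = 1 := Matrix.nonsing_inv_mul _ (Ne.isUnit ht)
  have hM' : (1 - t • (A * S)) * M = 1 := Matrix.mul_nonsing_inv _ (Ne.isUnit ht)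
  have hanti : (M * A).transpose = -(M * A) :=
    transpose_resolvent_mul_pairing ℂ (hA ▸ transpose_pairing_eq_neg ℂ C)
      (show (t • S).transpose = -(t • S) by rw [Matrix.transpose_smul, hS, transpose_sub_transpose_eq_neg, smul_neg])
      (resolvent_smul hM)
  have hcoc : (fun s : ℂ => (1 - s • (A * S)).det) =
      fun s => (1 - t • (A * S)).det * (1 - (s - t) • (M * A * S)).det := by
    funext s
    have h := det_one_sub_add_smul hM' (s - t)
    rwa [add_sub_cancel, ← Matrix.mul_assoc] at h
  have h0 : HasDerivAt (fun s : ℂ => (1 - s • (M * A * S)).det) (-(M * A * S).trace) (t - t) := by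
    rw [sub_self]
    exact hasDerivAt_det_one_sub_smul_zero (M * A * S)
  have h1 : HasDerivAt (fun s : ℂ => (1 - (s - t) • (M * A * S)).det) (-(M * A * S).trace * 1) t :=
    h0.comp t (h := fun s : ℂ => s - t) ((hasDerivAt_id t).sub_const t)
  rw [hcoc, ← neg_trace_mul_eq_two_mul_sum hanti hS]
  simpa using h1.const_mul ((1 - t • (A * S)).det)

/-! ### The identity -/

/-- **The square of the Gaussian integral of a Gaussian is the determinant**:
`(∫ dμ_C e^{Σ N(X,Y)ψ(X)ψ(Y)})² = det(1 − A S)`, `A(X,Y) = ½(C(Y,X) − C(X,Y))`, `S = N − Nᵀ` — for EVERY covariance `C` and every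
`N` over `ℂ` (the Pfaffian identity `Pf² = det` in Laplacian form; Feldman–Knörrer–Trubowitz 2002, §I.3–I.4).
[cite: FeldmanKnorrerTrubowitz2002, §I.3–I.4] -/
theorem sq_gaussExpect_grassmannExp_eq_det :
    gaussExpect ℂ C (grassmannExp q) ^ 2 = (1 - A * S).det := by
  -- abbreviations
  set Z : ℂ → ℂ := fun s => gaussExpect ℂ C (grassmannExp (s • q)) with hZ
  set D : ℂ → ℂ := fun s => (1 - s • (A * S)).det with hD
  -- (1) a ball around `0` on which `D ≠ 0`
  have hDcont : Continuous D := by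
    have : D = fun s => (Matrix.det (1 + (X : ℂ[X]) • (-(A * S)).map Polynomial.C)).eval s := by
      funext s; exact (eval_det_one_add_X_smul_neg (A * S) s).symm
    rw [this]
    exact Polynomial.continuous _
  have hD0 : D 0 = 1 := by simp [hD]
  obtain ⟨ε, hε, hball⟩ : ∃ ε > 0, Metric.ball (0 : ℂ) ε ⊆ {s | D s ≠ 0} := by
    have hopen : IsOpen {s : ℂ | D s ≠ 0} := isOpen_ne_fun hDcont continuous_const
    exact Metric.isOpen_iff.1 hopen 0 (by simp [hD0])
  -- (2) on the ball `Z² · D⁻¹` has zero derivative, hence equals its value `1` at `0`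
  have hderiv : ∀ s ∈ Metric.ball (0 : ℂ) ε, HasDerivAt (fun s => Z s ^ 2 * (D s)⁻¹) 0 s := by
    intro s hs
    have hDs : D s ≠ 0 := hball hs
    set ρ : ℂ := ∑ X, ∑ Y, N X Y * ((1 - s • (A * S))⁻¹ * A) X Y with hρ
    have hZ' : HasDerivAt Z (Z s * ρ) s := hasDerivAt_gaussExpect_grassmannExp_smul C N hq hA hS hDs
    have hD' : HasDerivAt D (D s * (2 * ρ)) s := hasDerivAt_det_one_sub_smul C N hA hS hDs
    have h := (hZ'.pow 2).mul (hD'.inv hDs)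
    refine h.congr_deriv ?_
    simp only [Pi.pow_apply, Pi.inv_apply]
    field_simp
    ring
  have hconst : ∀ s ∈ Metric.ball (0 : ℂ) ε, Z s ^ 2 * (D s)⁻¹ = 1 := by
    intro s hs
    have h := Metric.isOpen_ball.is_const_of_deriv_eq_zero (convex_ball (0 : ℂ) ε).isPreconnected
      (fun x hx => (hderiv x hx).differentiableAt.differentiableWithinAt)
      (fun x hx => (hderiv x hx).deriv) hs (Metric.mem_ball_self hε)
    rw [h]
    simp [hZ, hD, grassmannExp]
  have hball_eq : ∀ s ∈ Metric.ball (0 : ℂ) ε, Z s ^ 2 = D s := fun s hs =>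
    (mul_inv_eq_one₀ (hball hs)).1 (hconst s hs)
  -- (3) both sides are polynomials in `s`; they agree on a ball, hence everywhere, in particular at `s = 1`
  set PZ : ℂ[X] := ∑ k ∈ Finset.range (Fintype.card Γ + 2),
    Polynomial.C (((k.factorial : ℂ))⁻¹ * gaussExpect ℂ C (q ^ k)) * X ^ k with hPZ
  set PD : ℂ[X] := Matrix.det (1 + (X : ℂ[X]) • (-(A * S)).map Polynomial.C) with hPD
  have hP : PZ ^ 2 - PD = 0 := by
    refine Polynomial.eq_zero_of_infinite_isRoot _ ?_
    refine ((infinite_of_mem_nhds (0 : ℂ) (Metric.ball_mem_nhds 0 hε)).mono fun s hs => ?_)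
    rw [Set.mem_setOf_eq, Polynomial.IsRoot, Polynomial.eval_sub, Polynomial.eval_pow, hPZ, hPD,
      ← gaussExpect_grassmannExp_smul_eq_eval C N hq s, eval_det_one_add_X_smul_neg, sub_eq_zero]
    exact hball_eq s hs
  have h1 := congrArg (Polynomial.eval (1 : ℂ)) hP
  rw [Polynomial.eval_sub, Polynomial.eval_pow, Polynomial.eval_zero, hPZ, hPD, ← gaussExpect_grassmannExp_smul_eq_eval C N hq 1,
    eval_det_one_add_X_smul_neg, sub_eq_zero, one_smul, one_smul] at h1
  exact h1

omit hA in
/-- **Antisymmetric covariance**: `(∫ dμ_C e^{Σ N ψψ})² = det(1 + C S)` for `Cᵀ = −C`, `S = N − Nᵀ`. [cite: FeldmanKnorrerTrubowitz2002, §I.3–I.4] -/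
theorem sq_gaussExpect_grassmannExp_eq_det_of_transpose_eq_neg (hC : C.transpose = -C) :
    gaussExpect ℂ C (grassmannExp q) ^ 2 = (1 + C * S).det := by
  have h := sq_gaussExpect_grassmannExp_eq_det C N hq (A := -C) (pairing_eq_neg_of_transpose_eq_neg ℂ hC).symm hS
  rwa [neg_mul, sub_neg_eq_add] at h

end Complex

end Literature.MathematicalPhysics.QuantumLattice
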